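import Literature.IUT.HodgeArakelov.GaloisPairRigidity

/-!
# [IUTchII] §1, Corollary 1.11: the functor `ℛ → ℱ` of the multiradial MLF-Galois pair cyclotomic
# rigidity isomorphisms (sub-DAG rows S0–S6 of `plan/L6/SUBDAG-IUTchII-Cor-111.md`)

Mochizuki, *Inter-universal Teichmüller theory II*, §1, Corollary 1.11, kurims manuscript (Dec. 2020)
p. 49 [claim: Mochizuki2012, status: disputed] (IUTchII §1 Cor 1.11, kurims p.49). Record-only typing
under the claim key `Mochizuki2012` (D-0012, disputed); abc-iut cell, layer L6, D-0068 (1) sub-DAG of the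
node `IUTchII:Cor1.11` (holder abc-iut-w5-d089). Companion of the landed `GaloisPairRigidity.lean`
(abc-iut-L6-t1, p409065), which types the DATA of Corollary 1.11 (`GaloisPairRigidityData`: `μ_Ẑ(G)`, the
cyclotomic rigidity isomorphism `(*bs-Gal_{G,⊳})` of [AbsTopIII] Rmk. 3.2.1, the isomorphism
`μ_Ẑ(Π/Δ) ≅ (l·Δ_Θ)(Π)` of [AbsTopIII] Cor. 1.10 (c)), DEFINES the orbits `orbitA` ((a), the `Γ`-orbit)
and `orbitB` ((b), the `Aut(G)`-orbit), and PROVES the shape theorem `cor111_multiradiallyDefined` for EVERY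
functor out of the radial category `ℛ` of Example 1.8 (viii) — while recording that "the specific functor
`ℛ → ℱ` of the corollary … is NOT built here".

This file BUILDS that functor, i.e. types (and, the proof being formal, proves) the clause (p. 49
ll. 36–44, read on the page): "Then the data consisting of the triple `(Π, G, α)` [cf. Example 1.8, (i)],
the topological `G`-modules constituted by the domain and codomain of `(*bs-Gal_{G,⊳})`, the topological
`Π`-module constituted by the codomain of `(*bs-Gal_{G,Π})`, and the poly-isomorphisms `(*bs-Gal_{G,⊳})`
and `(*bs-Gal_{G,Π})` determines a functor `ℛ → ℱ` which arises from a functorial algorithm in the triple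
`(Π, G, α)`", whose printed proof (p. 49 ll. 47–48) is "The various assertions of Corollary 1.11 follow
immediately from the definitions involved." The kernel content of "functorial algorithm" is: the orbits (a),
(b) are carried to the orbits (a), (b) by the isomorphisms that an isomorphism of radial data induces on
the three groups (rows S1–S4′), and these induced isomorphisms satisfy the functor laws (row S5).

* S0 `cyclotome.mapEquiv` — functoriality of the tree's cyclotome `Λ(−)` (= `μ_Ẑ(−) = Hom(ℚ/ℤ, −)`,
  LANA §6.1, `Literature.AnabelianGeometry.EtaleTheta.cyclotome`) on ISOMORPHISMS (generic helper).
* S1 `GaloisPairRigidityData.orbitA_twist_mem` — the `Γ`-orbit (a) is `Γ`-stable. PROVED.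
* S2 `GaloisPairRigidityData.orbitA_map_mem` — (a) is NATURAL in isomorphisms `G ≅ G*` (from the
  naturality laws `twist_natural`, `bsGalTri_natural` of the interface). PROVED.
* S3 `GaloisPairRigidityData.orbitB_map_mem` — the `Aut(G)`-orbit (b) is carried to itself along
  `G' ≅ G` (functor law `mapMu_comp`). PROVED.
* S4 `GaloisPairRigidityData.PiTransport` — INPUT structure: the functoriality IN `Π` that the landed
  interface does not carry — the isomorphism `Π/Δ ≅ Π*/Δ*` induced by `Π ≅ Π*` (pinned by `quotHom_mk`),
  the transport of `(l·Δ_Θ)(−)` ([EtTh] Cor. 2.18 (i): a functorial group-theoretic algorithm) and the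
  naturality of the [AbsTopIII] Cor. 1.10 (c) isomorphism `corPiX`. Instance owed by the producer of
  `GaloisPairRigidityData` over genuine data (cell MERGE-MAP row B12). S4′ `orbitB_mapLD_mem` — (b) is
  carried to itself along `Π ≅ Π*`. PROVED modulo the S4 input.
* S5 `Cor111Tuple` (the target category `ℱ`: tuples `(μ_Ẑ(G), μ_Ẑ(O^×(G)), (l·Δ_Θ)(Π), (a), (b))`,
  morphisms = triples of group isomorphisms carrying orbit into orbit) and
  `GaloisPairRigidityData.cor111Functor : ℛ ⥤ Cor111Tuple` — THE functor; functor laws PROVED.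
* S6 `cor111Functor_multiradiallyDefined` — "the resulting natural functor `Ψ_ℛ : ℛ → ℛ†` is
  multiradially defined" AT this functor (instance of the shape theorem).

HONEST LIMITS (as for the landed interface): (α) the topological MODULE structures of the tuple entries
(the `G`- and `Π`-actions and topologies of "topological `G`-modules … topological `Π`-module") are not carried
by `GaloisPairRigidityData`, hence not by `Cor111Tuple`; (β) a morphism of the coric data of Example 1.8
(viii) is "a `Γ`-multiple of the isomorphism … induced by an isomorphism of topological groups `G ≅ G*`"
(p. 41 ll. 25–30) — the `Γ`-multiple acts on `O^{×μ}(G)`; on the cyclotomes the functor below records the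
UNTWISTED induced isomorphisms, the `Γ`-indeterminacy being exactly absorbed by the `Γ`-orbit (a) (S1:
twisting a member of the orbit by `γ ∈ Γ` stays in the orbit) — this is the rôle the printed text assigns to
the orbit; (γ) `Γ ⊆ Ẑ^×` enters `orbitA` as an abstract subgroup (closedness not modelled: `ZHatUnits`
carries no topology in the tree) and the radial category as the abstract twisting group `Γ'` of
`ex18iii S Γ'` (universe-lifted underlying group). Nothing here asserts anything about [IUTchIII] Cor. 3.12;
no new named fact is introduced; typed ≠ discharged elsewhere.
-/

namespace Literature.AnabelianGeometry.EtaleTheta.cyclotome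

universe u

variable {A B C : Type u} [CommGroup A] [CommGroup B] [CommGroup C]

/-- S0. Functoriality of the cyclotome `Λ(−) = Hom(ℚ/ℤ, −)` on isomorphisms: a group isomorphism
`e : A ≃* B` induces `Λ(e) : Λ(A) ≃* Λ(B)` (componentwise; inverse `Λ(e⁻¹)`). Generic helper over the
landed `cyclotome.map`. [cite: LANA2026Report, §6.1 p.32] -/
def mapEquiv (e : A ≃* B) : cyclotome A ≃* cyclotome B where
  toFun := cyclotome.map e.toMonoidHom
  invFun := cyclotome.map e.symm.toMonoidHom
  left_inv ζ := Subtype.ext (funext fun n => by simp)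
  right_inv ζ := Subtype.ext (funext fun n => by simp)
  map_mul' ζ ξ := map_mul _ ζ ξ

/-- Components of `Λ(e)`. [cite: LANA2026Report, §6.1 p.32] -/
@[simp] theorem mapEquiv_apply (e : A ≃* B) (ζ : cyclotome A) (n : ℕ+) :
    ((mapEquiv e ζ : cyclotome B) : ℕ+ → B) n = e ((ζ : ℕ+ → A) n) := rfl

/-- `Λ(e)` on elements is `Λ` of the underlying homomorphism. [cite: LANA2026Report, §6.1 p.32] -/
theorem mapEquiv_apply_eq_map (e : A ≃* B) (ζ : cyclotome A) :
    mapEquiv e ζ = cyclotome.map e.toMonoidHom ζ := rfl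

/-- `Λ(id) = id`. [cite: LANA2026Report, §6.1 p.32] -/
@[simp] theorem mapEquiv_refl : mapEquiv (MulEquiv.refl A) = MulEquiv.refl (cyclotome A) :=
  MulEquiv.ext fun _ => Subtype.ext (funext fun _ => rfl)

/-- `Λ(e ≫ f) = Λ(e) ≫ Λ(f)`. [cite: LANA2026Report, §6.1 p.32] -/
theorem mapEquiv_trans (e : A ≃* B) (f : B ≃* C) :
    mapEquiv (e.trans f) = (mapEquiv e).trans (mapEquiv f) :=
  MulEquiv.ext fun _ => Subtype.ext (funext fun _ => rfl)

end Literature.AnabelianGeometry.EtaleTheta.cyclotome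

namespace Literature.IUT.HodgeArakelov

open CategoryTheory
open Literature.AnabelianGeometry.EtaleTheta

universe u

variable {S : ThetaSetting.{u}}

/-! ## The object `Π/Δ` of `IsoClass G_k` and the isomorph underlying a twisted isomorph -/

/-- The object `Π/Δ ∈ IsoClass G_k` attached to `Π ≅ Π^tp_{X̲̲_k}` (Ex. 1.8 (i): "`α : Π/Δ ≅ G`"), as
used throughout `GaloisPairRigidity.lean` (there written inline). [claim: Mochizuki2012, status: disputed]
(IUTchII §1 Ex 1.8 (i), kurims p.35) -/
abbrev AbsTopMonoids.quotObj (A : AbsTopMonoids S) (P : IsoClass S.PiX) : IsoClass S.Gk :=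
  ⟨TopGroup.quot P.G (A.Delta P), A.quotIso P⟩

/-- The isomorph of `G_k` underlying an object of the twisted groupoid of Ex. 1.8 (iii)/(viii) (same
topological group, morphisms forgotten down to their inducing isomorphism). [claim: Mochizuki2012, status:
disputed] (IUTchII §1 Ex 1.8 (iii), kurims p.38) -/
abbrev TwistedIsoClass.toIso {Γ : Type u} [Group Γ] (X : TwistedIsoClass S.Gk Γ) : IsoClass S.Gk :=
  ⟨X.G, X.iso⟩

/-- The isomorphism of topological groups `G ≅ G*` underlying a morphism `(e, γ)` of the twisted groupoid,
as a morphism of `IsoClass G_k`. [claim: Mochizuki2012, status: disputed] (IUTchII §1 Ex 1.8 (iii), kurims p.38) -/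
abbrev TwistedIsoClass.Hom.toIsoHom {Γ : Type u} [Group Γ] {X Y : TwistedIsoClass S.Gk Γ} (f : X ⟶ Y) :
    X.toIso ⟶ Y.toIso :=
  TwistedIsoClass.Hom.iso f

namespace GaloisPairRigidityData

variable {A : AbsTopMonoids S} (D : GaloisPairRigidityData A)

/-! ## S1–S3: the orbits (a), (b) are stable / natural -/

/-- **S1** (IUTchII:Cor1.11 (a), kurims p. 49 l. 9 "the `Γ`-orbit"): the orbit `(*bs-Gal_{G,⊳})` is
stable under the `Γ`-twist — twisting a member by `γ ∈ Γ` gives a member. PROVED (`twist` is a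
homomorphism). [claim: Mochizuki2012, status: disputed] (IUTchII §1 Cor 1.11, kurims p.49) -/
theorem orbitA_twist_mem (Γ : Subgroup ZHatUnits) (G : IsoClass S.Gk) {γ : ZHatUnits} (hγ : γ ∈ Γ)
    {φ : D.muZhat G ≃* A.muZhatUnits G} (hφ : φ ∈ D.orbitA Γ G) :
    (D.twist G γ).trans φ ∈ D.orbitA Γ G := by
  obtain ⟨γ', hγ', rfl⟩ := hφ
  refine ⟨γ' * γ, Γ.mul_mem hγ' hγ, ?_⟩
  ext x
  simp [MulEquiv.trans_apply, map_mul, MulAut.mul_apply]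

/-- **S2** (IUTchII:Cor1.11 (a) with p. 49 l. 43 "functorial algorithm"): the orbit `(*bs-Gal_{G,⊳})` is
NATURAL in isomorphisms `f : G ≅ G*` — conjugating a member at `G` by the induced isomorphisms `μ_Ẑ(f)`
(`mapMu f`) and `μ_Ẑ(O^×(f))` (`Λ` of the units of `mapOtri f`) gives a member at `G*`. PROVED from the
interface laws `twist_natural`, `bsGalTri_natural`. [claim: Mochizuki2012, status: disputed]
(IUTchII §1 Cor 1.11, kurims p.49) -/
theorem orbitA_map_mem (Γ : Subgroup ZHatUnits) {G H : IsoClass S.Gk} (f : G ⟶ H)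
    {φ : D.muZhat G ≃* A.muZhatUnits G} (hφ : φ ∈ D.orbitA Γ G) :
    (D.mapMu f).symm.trans (φ.trans (cyclotome.mapEquiv (Units.mapEquiv (A.mapOtri f)))) ∈
      D.orbitA Γ H := by
  obtain ⟨γ, hγ, rfl⟩ := hφ
  refine ⟨γ, hγ, ?_⟩
  ext x
  -- unfold the composite at `x`, then substitute `x = mapMu f y`
  obtain ⟨y, rfl⟩ : ∃ y, x = D.mapMu f y := ⟨(D.mapMu f).symm x, by simp⟩
  simp only [MulEquiv.trans_apply, MulEquiv.symm_apply_apply]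
  rw [← D.twist_natural f γ y, D.bsGalTri_natural f]
  rfl

/-- **S3** (IUTchII:Cor1.11 (b), kurims p. 49 ll. 22–35 "the `Aut(G)`-orbit … obtained by composing the
poly-isomorphism induced by applying `μ_Ẑ(−)` to the [inverse of the] full poly-isomorphism … `α : Π/Δ ≅ G`
with the natural isomorphism … of [AbsTopIII], Corollary 1.10, (c)"): the orbit `(*bs-Gal_{G,Π})` is carried
to itself along any isomorphism `e : G' ≅ G` (precomposition with `μ_Ẑ(e)`). PROVED (`mapMu_comp`).
[claim: Mochizuki2012, status: disputed] (IUTchII §1 Cor 1.11, kurims p.49) -/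
theorem orbitB_map_mem (P : IsoClass S.PiX) {G G' : IsoClass S.Gk} (e : G' ⟶ G)
    {φ : D.muZhat G ≃* D.lDeltaTheta P} (hφ : φ ∈ D.orbitB P G) :
    (D.mapMu e).trans φ ∈ D.orbitB P G' := by
  obtain ⟨e', rfl⟩ := hφ
  refine ⟨e ≫ e', ?_⟩
  rw [D.mapMu_comp]
  exact MulEquiv.ext fun _ => rfl

/-! ## S4: the functoriality in `Π` (INPUT structure) -/

/-- **S4** (INPUT; IUTchII:Cor1.11 (b) with p. 49 l. 43 "a functorial algorithm in the triple
`(Π, G, α)`"): the functoriality IN `Π` of the codomain `(l·Δ_Θ)(Π)` of `(*bs-Gal_{G,Π})` and of the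
[AbsTopIII] Cor. 1.10 (c) isomorphism, which the landed interface `GaloisPairRigidityData` does not carry:
* `quotHom h` — the isomorphism of topological groups `Π/Δ ≅ Π*/Δ*` induced by `h : Π ≅ Π*` (`Δ` is
  group-theoretic: `AbsTopMonoids.Delta_map`), PINNED by `quotHom_mk` to be the induced map on cosets,
  with its functor laws;
* `mapLD h : (l·Δ_Θ)(Π) ≅ (l·Δ_Θ)(Π*)` — "`(l·Δ_Θ)(Π)`" is the output of a functorial group-theoretic
  algorithm ([EtTh] Cor. 2.18 (i)), with functor laws;
* `corPiX_natural` — naturality of "the natural isomorphism `μ_Ẑ(G_k) ≅ μ_Ẑ(Π_X)` of [AbsTopIII],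
  Corollary 1.10, (c)" (`corPiX`) with respect to `h`.
Instance owed by the producer of `GaloisPairRigidityData` over genuine data (TODO-merge: cell MERGE-MAP row
B12 / abc-iut-L4-t1 `muZhat.congr`). [claim: Mochizuki2012, status: disputed] (IUTchII §1 Cor 1.11, kurims p.49) -/
structure PiTransport (D : GaloisPairRigidityData A) : Type (u + 1) where
  /-- `Π/Δ ≅ Π*/Δ*` induced by `Π ≅ Π*` -/
  quotHom : ∀ {P Q : IsoClass S.PiX}, (P ⟶ Q) → (A.quotObj P ⟶ A.quotObj Q)
  quotHom_id : ∀ P : IsoClass S.PiX, quotHom (𝟙 P) = 𝟙 (A.quotObj P)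
  quotHom_comp : ∀ {P Q R : IsoClass S.PiX} (f : P ⟶ Q) (g : Q ⟶ R),
    quotHom (f ≫ g) = quotHom f ≫ quotHom g
  /-- `quotHom h` IS the map induced on cosets -/
  quotHom_mk : ∀ {P Q : IsoClass S.PiX} (h : P ⟶ Q) (x : P.G),
    IsoClass.homIso (quotHom h) (QuotientGroup.mk x : P.G ⧸ A.Delta P) =
      (QuotientGroup.mk (IsoClass.homIso h x) : Q.G ⧸ A.Delta Q)
  /-- transport of `(l·Δ_Θ)(−)` along `Π ≅ Π*` -/
  mapLD : ∀ {P Q : IsoClass S.PiX}, (P ⟶ Q) → (D.lDeltaTheta P ≃* D.lDeltaTheta Q)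
  mapLD_id : ∀ P : IsoClass S.PiX, mapLD (𝟙 P) = MulEquiv.refl (D.lDeltaTheta P)
  mapLD_comp : ∀ {P Q R : IsoClass S.PiX} (f : P ⟶ Q) (g : Q ⟶ R),
    mapLD (f ≫ g) = (mapLD f).trans (mapLD g)
  /-- naturality of the [AbsTopIII] Cor. 1.10 (c) isomorphism -/
  corPiX_natural : ∀ {P Q : IsoClass S.PiX} (h : P ⟶ Q) (x : D.muZhat (A.quotObj P)),
    D.corPiX Q (D.mapMu (quotHom h) x) = mapLD h (D.corPiX P x)

/-- **S4′** (IUTchII:Cor1.11 (b) + l. 43): given the `Π`-functoriality input, the orbit `(*bs-Gal_{G,Π})`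
at `Π` is carried INTO the orbit at `Π*` by post-composition with `mapLD h` (the member through
`e : G ≅ Π/Δ` goes to the member through `e ≫ quotHom h : G ≅ Π*/Δ*`). PROVED modulo the input.
[claim: Mochizuki2012, status: disputed] (IUTchII §1 Cor 1.11, kurims p.49) -/
theorem orbitB_mapLD_mem (T : D.PiTransport) {P Q : IsoClass S.PiX} (h : P ⟶ Q) (G : IsoClass S.Gk)
    {φ : D.muZhat G ≃* D.lDeltaTheta P} (hφ : φ ∈ D.orbitB P G) :
    φ.trans (T.mapLD h) ∈ D.orbitB Q G := by
  obtain ⟨e, rfl⟩ := hφ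
  refine ⟨e ≫ T.quotHom h, ?_⟩
  rw [D.mapMu_comp]
  ext x
  simp only [MulEquiv.trans_apply]
  exact (T.corPiX_natural h (D.mapMu e x)).symm

end GaloisPairRigidityData

/-! ## S5: the target category `ℱ` and the functor `ℛ → ℱ` -/

/-- **S5** (IUTchII:Cor1.11, kurims p. 49 ll. 36–44), the objects of the target category `ℱ` of "a functor
`ℛ → ℱ`": tuples consisting of the three groups `μ_Ẑ(G)` (domain of both poly-isomorphisms),
`μ_Ẑ(O^×(G))` (codomain of `(*bs-Gal_{G,⊳})`), `(l·Δ_Θ)(Π)` (codomain of `(*bs-Gal_{G,Π})`) and the two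
poly-isomorphisms as SETS of group isomorphisms. (Topological module structures are not carried — see
the file docstring (α).) [claim: Mochizuki2012, status: disputed] (IUTchII §1 Cor 1.11, kurims p.49) -/
structure Cor111Tuple : Type (u + 1) where
  /-- `μ_Ẑ(G)` -/
  M : Type u
  /-- `μ_Ẑ(O^×(G))` -/
  U : Type u
  /-- `(l·Δ_Θ)(Π)` -/
  L : Type u
  [grpM : CommGroup M]
  [grpU : CommGroup U]
  [grpL : CommGroup L]
  /-- `(*bs-Gal_{G,⊳})` -/
  orbA : Set (M ≃* U)
  /-- `(*bs-Gal_{G,Π})` -/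
  orbB : Set (M ≃* L)

/-- The group structure on the `μ_Ẑ(G)`-entry of a tuple. [claim: Mochizuki2012, status: disputed]
(IUTchII §1 Cor 1.11, kurims p.49) -/
instance Cor111Tuple.instCommGroupM (X : Cor111Tuple.{u}) : CommGroup X.M := X.grpM

/-- The group structure on the `μ_Ẑ(O^×(G))`-entry of a tuple. [claim: Mochizuki2012, status: disputed]
(IUTchII §1 Cor 1.11, kurims p.49) -/
instance Cor111Tuple.instCommGroupU (X : Cor111Tuple.{u}) : CommGroup X.U := X.grpU

/-- The group structure on the `(l·Δ_Θ)(Π)`-entry of a tuple. [claim: Mochizuki2012, status: disputed]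
(IUTchII §1 Cor 1.11, kurims p.49) -/
instance Cor111Tuple.instCommGroupL (X : Cor111Tuple.{u}) : CommGroup X.L := X.grpL

namespace Cor111Tuple

/-- Morphisms of `ℱ`: triples of group isomorphisms under which the conjugate of every member of the
orbit (a), resp. (b), at the source is a member of the orbit (a), resp. (b), at the target ("the
poly-isomorphisms … determine a functor"). [claim: Mochizuki2012, status: disputed] (IUTchII §1 Cor 1.11, kurims p.49) -/
@[ext]
structure Hom (X Y : Cor111Tuple.{u}) : Type u where
  /-- on `μ_Ẑ(G)` -/
  m : X.M ≃* Y.M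
  /-- on `μ_Ẑ(O^×(G))` -/
  u : X.U ≃* Y.U
  /-- on `(l·Δ_Θ)(Π)` -/
  l : X.L ≃* Y.L
  mapsA : ∀ φ ∈ X.orbA, m.symm.trans (φ.trans u) ∈ Y.orbA
  mapsB : ∀ φ ∈ X.orbB, m.symm.trans (φ.trans l) ∈ Y.orbB

/-- `ℱ` is a category (composition = composition of the three isomorphisms). [claim: Mochizuki2012, status:
disputed] (IUTchII §1 Cor 1.11, kurims p.49) -/
instance : Category.{u} Cor111Tuple.{u} where
  Hom := Hom
  id X :=
    { m := MulEquiv.refl X.M, u := MulEquiv.refl X.U, l := MulEquiv.refl X.L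
      mapsA := fun φ hφ => by
        have : (MulEquiv.refl X.M).symm.trans (φ.trans (MulEquiv.refl X.U)) = φ :=
          MulEquiv.ext fun _ => rfl
        rw [this]; exact hφ
      mapsB := fun φ hφ => by
        have : (MulEquiv.refl X.M).symm.trans (φ.trans (MulEquiv.refl X.L)) = φ :=
          MulEquiv.ext fun _ => rfl
        rw [this]; exact hφ }
  comp f g :=
    { m := f.m.trans g.m, u := f.u.trans g.u, l := f.l.trans g.l
      mapsA := fun φ hφ => by
        have : (f.m.trans g.m).symm.trans (φ.trans (f.u.trans g.u)) =
            g.m.symm.trans ((f.m.symm.trans (φ.trans f.u)).trans g.u) :=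
          MulEquiv.ext fun _ => rfl
        rw [this]; exact g.mapsA _ (f.mapsA φ hφ)
      mapsB := fun φ hφ => by
        have : (f.m.trans g.m).symm.trans (φ.trans (f.l.trans g.l)) =
            g.m.symm.trans ((f.m.symm.trans (φ.trans f.l)).trans g.l) :=
          MulEquiv.ext fun _ => rfl
        rw [this]; exact g.mapsB _ (f.mapsB φ hφ) }
  id_comp f := Hom.ext (MulEquiv.ext fun _ => rfl) (MulEquiv.ext fun _ => rfl) (MulEquiv.ext fun _ => rfl)
  comp_id f := Hom.ext (MulEquiv.ext fun _ => rfl) (MulEquiv.ext fun _ => rfl) (MulEquiv.ext fun _ => rfl)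
  assoc f g h :=
    Hom.ext (MulEquiv.ext fun _ => rfl) (MulEquiv.ext fun _ => rfl) (MulEquiv.ext fun _ => rfl)

end Cor111Tuple

namespace GaloisPairRigidityData

variable {A : AbsTopMonoids S} (D : GaloisPairRigidityData A)

/-- **S5** (IUTchII:Cor1.11, kurims p. 49 ll. 36–44): **the functor `ℛ → ℱ`** "which arises from a
functorial algorithm in the triple `(Π, G, α)`", on the radial category `ℛ` of Example 1.8 (viii) (shape
`ex18iii S Γ'`: objects `(Π, G)`, morphisms `(h : Π ≅ Π*, (e : G ≅ G*, γ ∈ Γ'))`): on objects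
`(Π, G) ↦ (μ_Ẑ(G), μ_Ẑ(O^×(G)), (l·Δ_Θ)(Π), (*bs-Gal_{G,⊳}) = orbitA Γ G, (*bs-Gal_{G,Π}) = orbitB Π G)`;
on morphisms the induced isomorphisms `(μ_Ẑ(e), Λ(O^×(e)), (l·Δ_Θ)(h))` (`mapMu`,
`cyclotome.mapEquiv ∘ Units.mapEquiv ∘ mapOtri`, `T.mapLD`) — well defined on the orbits by S1–S4′; functor
laws from `mapMu_id/_comp`, `mapOtri_id/_comp`, `mapLD_id/_comp`. PROVED (construction), modulo the
`Π`-transport input `T`. [claim: Mochizuki2012, status: disputed] (IUTchII §1 Cor 1.11, kurims p.49) -/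
def cor111Functor (Γ : Subgroup ZHatUnits) (T : D.PiTransport) (Γ' : Type u) [Group Γ'] :
    IsoClass S.PiX × TwistedIsoClass S.Gk Γ' ⥤ Cor111Tuple.{u} where
  obj X :=
    { M := D.muZhat X.2.toIso, U := A.muZhatUnits X.2.toIso, L := D.lDeltaTheta X.1
      orbA := D.orbitA Γ X.2.toIso, orbB := D.orbitB X.1 X.2.toIso }
  map {X Y} f :=
    { m := D.mapMu f.2.toIsoHom
      u := cyclotome.mapEquiv (Units.mapEquiv (A.mapOtri f.2.toIsoHom))
      l := T.mapLD f.1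
      mapsA := fun φ hφ => D.orbitA_map_mem Γ f.2.toIsoHom hφ
      mapsB := fun φ hφ => by
        -- along `G ≅ G*`: precompose with `μ_Ẑ(e)⁻¹ = μ_Ẑ(e⁻¹)`; along `Π ≅ Π*`: postcompose with `mapLD`
        have h1 : (D.mapMu f.2.toIsoHom).symm.trans φ ∈ D.orbitB X.1 Y.2.toIso := by
          have hs : (D.mapMu f.2.toIsoHom).symm = D.mapMu (inv f.2.toIsoHom) := by
            apply MulEquiv.ext
            intro x
            apply (D.mapMu f.2.toIsoHom).injective
            rw [MulEquiv.apply_symm_apply, ← MulEquiv.trans_apply, ← D.mapMu_comp, IsIso.inv_hom_id,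
              D.mapMu_id]
            rfl
          rw [hs]
          exact D.orbitB_map_mem X.1 _ hφ
        have h2 := D.orbitB_mapLD_mem T f.1 Y.2.toIso h1
        have h3 : ((D.mapMu f.2.toIsoHom).symm.trans φ).trans (T.mapLD f.1) =
            (D.mapMu f.2.toIsoHom).symm.trans (φ.trans (T.mapLD f.1)) :=
          MulEquiv.ext fun _ => rfl
        rw [h3] at h2
        exact h2 }
  map_id X := by
    refine Cor111Tuple.Hom.ext ?_ ?_ ?_
    · show D.mapMu (𝟙 X.2.toIso) = MulEquiv.refl _
      exact D.mapMu_id _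
    · show cyclotome.mapEquiv (Units.mapEquiv (A.mapOtri (𝟙 X.2.toIso))) = MulEquiv.refl _
      rw [A.mapOtri_id]
      exact MulEquiv.ext fun x => Subtype.ext (funext fun n => Units.ext rfl)
    · show T.mapLD (𝟙 X.1) = MulEquiv.refl _
      exact T.mapLD_id _
  map_comp {X Y Z} f g := by
    refine Cor111Tuple.Hom.ext ?_ ?_ ?_
    · show D.mapMu (f.2.toIsoHom ≫ g.2.toIsoHom) = (D.mapMu f.2.toIsoHom).trans (D.mapMu g.2.toIsoHom)
      exact D.mapMu_comp _ _
    · show cyclotome.mapEquiv (Units.mapEquiv (A.mapOtri (f.2.toIsoHom ≫ g.2.toIsoHom))) =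
        (cyclotome.mapEquiv (Units.mapEquiv (A.mapOtri f.2.toIsoHom))).trans
          (cyclotome.mapEquiv (Units.mapEquiv (A.mapOtri g.2.toIsoHom)))
      rw [A.mapOtri_comp]
      exact MulEquiv.ext fun x => Subtype.ext (funext fun n => Units.ext rfl)
    · show T.mapLD (f.1 ≫ g.1) = (T.mapLD f.1).trans (T.mapLD g.1)
      exact T.mapLD_comp _ _

end GaloisPairRigidityData

/-! ## S6: "`Ψ_ℛ : ℛ → ℛ†` is multiradially defined" at the functor of record -/

/-- **S6** (IUTchII:Cor1.11, kurims p. 49 ll. 44–46): "denote the corresponding graph [cf. Example 1.9,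
(i)] by `ℛ†`. In particular, the resulting natural functor `Ψ_ℛ : ℛ → ℛ†` [cf. Example 1.9, (i)] is
multiradially defined" — AT the functor `ℛ → ℱ` built above (instance of the shape theorem
`cor111_multiradiallyDefined`, which is the printed proof "follow immediately from the definitions
involved"). [claim: Mochizuki2012, status: disputed] (IUTchII §1 Cor 1.11, kurims p.49) -/
theorem cor111Functor_multiradiallyDefined {A : AbsTopMonoids S} (D : GaloisPairRigidityData A)
    (Γ : Subgroup ZHatUnits) (T : D.PiTransport) (Γ' : Type u) [Group Γ'] :
    ((ex18iii S Γ').toDagger (D.cor111Functor Γ T Γ')).IsMultiradiallyDefined :=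
  cor111_multiradiallyDefined S Γ' (D.cor111Functor Γ T Γ')

/-- The daggered environment `(ℛ†, 𝒞, Φ†)` of Corollary 1.11 (the graph of the functor of record), for
use by consumers (Rmk. 1.11.5 (ii), [IUTchII] Cor. 4.x). [claim: Mochizuki2012, status: disputed]
(IUTchII §1 Cor 1.11, kurims p.49) -/
def cor111DaggerOfRecord {A : AbsTopMonoids S} (D : GaloisPairRigidityData A) (Γ : Subgroup ZHatUnits)
    (T : D.PiTransport) (Γ' : Type u) [Group Γ'] : RadialEnvironment.{u, u + 1} :=
  (ex18iii S Γ').dagger (D.cor111Functor Γ T Γ')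

end Literature.IUT.HodgeArakelov
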